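import Summits.Ventures.PercRepro.S1DisjointSumCircuitTools
import Summits.Ventures.PercRepro.S1DisjointSumCircuitFour
import Summits.Ventures.PercRepro.SevenThreeQThree
import Summits.Ventures.PercRepro.PhiCredit
import Summits.Ventures.PercRepro.RankLevelSetFrameQM

/-!
# PercRepro — THE TRIANGLE-SUMMAND CONSUMER AT `(9, 4)`: CONDITIONAL ON THE CELL `(7, 4)` OF THE OTHER PART, AND
UNCONDITIONAL ON 11 POINTS (p2, gen 28; SUBCLAIM-S1 §6.10 (xvii)(b), (g))

For `M` of rank `7` and `N` a triangle, the `(9, 4)` body on `M ⊕ N` follows from the cells `(7, 4)` and `(7, 3)`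
of `M`: `#U ≤ N_M(7, 4) + 3 N_M(7, 3)`, `#Y ≥ 4 f_M(3) + 7 f_M(4) + 8 f_M(5) + 8 f_M(6) + 4 f_M(7)`, and
`Φ(9, 4) · #U ≤ 3 (f_M(5) + f_M(6)) + 4.5 (f_M(4) + f_M(5) + f_M(6))` by `Φ(7, 4) = 14/5`, `Φ(7, 3) = 28/5`.
The cell `(7, 3)` is a tree theorem (`SevenThree.c025_three_all`); the cell `(7, 4)` is OPEN in general, but it is
a tree theorem when `|M.E| = 11` (Theorem M, `ThmN.RLS_of_ncard_eq`: the tight layer `|E| = p + q`) and when every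
circuit of `M` has at least `6` elements (Theorem G′, `ThmN.RLS_of_circuits`). Hence **every `(9, 5)` core with a
triangle summand satisfies the `(9, 4)` body**: its other part has rank `7` on `11` points. Nothing else is claimed
about any cell ((9, 5) itself stays open on its connected cores and on its 1-separable cores with two non-circuit
parts).

* `ySet_eq_rankSet_union3_of_eq` — the `Y`-set of a cell `(q + 4, q)`;
* `ncard_Y_nine_four_triangle_ge` — the `Y`-side; `consumer_arith_nine_four_triangle`;
* **`c025_nine_four_disjointSum_triangle_of_rls`** — the conditional consumer (on `RLS M 7 4`);
* **`c025_nine_four_disjointSum_triangle_of_ncard`** — `|M.E| = 11`: every `(9, 5)` core with a triangle summand;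
* `c025_nine_four_disjointSum_triangle_of_circuits` — every circuit of `M` has `≥ 6` elements.
Axioms: standard.
-/

open scoped Matroid

namespace PercRepro

namespace S1

open Set

variable {α : Type}

/-- The `Y`-set of a cell `(q + 4, q)` is the union of the rank levels `q + 1`, `q + 2`, `q + 3`. -/
theorem ySet_eq_rankSet_union3_of_eq (M : Matroid α) {q p k k' k'' : ℕ} (hk : k = q + 1) (hk' : k' = q + 2)
    (hk'' : k'' = q + 3) (hp : p = q + 4) :
    {A : Set α | A ⊆ M.E ∧ (q : ℕ∞) < M.eRk A ∧ M.eRk A < (p : ℕ∞)} =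
      rankSet M k ∪ rankSet M k' ∪ rankSet M k'' := by
  ext A
  simp only [mem_setOf_eq, rankSet, mem_union]
  constructor
  · rintro ⟨hAE, h1, h2⟩
    obtain ⟨n, hn⟩ := ENat.ne_top_iff_exists.mp (ne_top_of_lt h2)
    rw [← hn] at h1 h2 ⊢
    have h1' : q < n := by exact_mod_cast h1
    have h2' : n < p := by exact_mod_cast h2
    rcases Nat.lt_or_ge n k' with h5 | h5
    · left; left
      refine ⟨hAE, ?_⟩
      have h3 : n = k := by omega
      rw [h3]
    rcases Nat.lt_or_ge n k'' with h6 | h6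
    · left; right
      refine ⟨hAE, ?_⟩
      have h3 : n = k' := by omega
      rw [h3]
    · right
      refine ⟨hAE, ?_⟩
      have h3 : n = k'' := by omega
      rw [h3]
  · rintro ((⟨hAE, hA⟩ | ⟨hAE, hA⟩) | ⟨hAE, hA⟩)
    · refine ⟨hAE, ?_⟩
      rw [hA]
      constructor
      · exact_mod_cast (show q < k by omega)
      · exact_mod_cast (show k < p by omega)
    · refine ⟨hAE, ?_⟩
      rw [hA]
      constructor
      · exact_mod_cast (show q < k' by omega)
      · exact_mod_cast (show k' < p by omega)
    · refine ⟨hAE, ?_⟩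
      rw [hA]
      constructor
      · exact_mod_cast (show q < k'' by omega)
      · exact_mod_cast (show k'' < p by omega)

/-- The `Y`-side at `(9, 4)`, triangle summand: `#Y ≥ 4 f_M(3) + 7 f_M(4) + 8 f_M(5) + 8 f_M(6) + 4 f_M(7)`. -/
theorem ncard_Y_nine_four_triangle_ge (M N : Matroid α) [M.Finite] [N.Finite] (h : Disjoint M.E N.E)
    (hN : N.IsCircuit N.E) (hN3 : N.E.ncard = 3) :
    4 * (rankSet M 3).ncard + 7 * (rankSet M 4).ncard + 8 * (rankSet M 5).ncard + 8 * (rankSet M 6).ncard +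
        4 * (rankSet M 7).ncard ≤
      {A : Set α | A ⊆ (M.disjointSum N h).E ∧ ((4 : ℕ) : ℕ∞) < (M.disjointSum N h).eRk A ∧
        (M.disjointSum N h).eRk A < ((9 : ℕ) : ℕ∞)}.ncard := by
  have hN3' : N.E.ncard = 2 + 1 := hN3
  rw [disjointSum_ncard_Y_eq_finsum M N h 9 4, finsum_mem_coe_finset]
  have hsub : ({(3, 2), (4, 1), (4, 2), (5, 0), (5, 1), (5, 2), (6, 0), (6, 1), (6, 2), (7, 0), (7, 1)} :
      Finset (ℕ × ℕ)) ⊆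
      (Finset.range 9 ×ˢ Finset.range 9).filter (fun x : ℕ × ℕ => 4 < x.1 + x.2 ∧ x.1 + x.2 < 9) := by
    decide
  refine le_trans ?_ (Finset.sum_le_sum_of_subset hsub)
  rw [Finset.sum_insert (by decide), Finset.sum_insert (by decide), Finset.sum_insert (by decide),
    Finset.sum_insert (by decide), Finset.sum_insert (by decide), Finset.sum_insert (by decide),
    Finset.sum_insert (by decide), Finset.sum_insert (by decide), Finset.sum_insert (by decide),
    Finset.sum_insert (by decide), Finset.sum_singleton]
  dsimp only
  have f0 : 1 ≤ (rankSet N 0).ncard := by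
    have := choose_le_ncard_rankSet_of_isCircuit_ground hN hN3' (a := 0) (by norm_num)
    rwa [Nat.choose_zero_right] at this
  have f1 : 3 ≤ (rankSet N 1).ncard := by
    have := choose_le_ncard_rankSet_of_isCircuit_ground hN hN3' (a := 1) (by norm_num)
    rwa [Nat.choose_one_right] at this
  have f2 : 4 ≤ (rankSet N 2).ncard := ncard_rankSet_top_of_isCircuit_ground hN hN3'
  have e32 := Nat.mul_le_mul_left (rankSet M 3).ncard f2
  have e41 := Nat.mul_le_mul_left (rankSet M 4).ncard f1
  have e42 := Nat.mul_le_mul_left (rankSet M 4).ncard f2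
  have e50 := Nat.mul_le_mul_left (rankSet M 5).ncard f0
  have e51 := Nat.mul_le_mul_left (rankSet M 5).ncard f1
  have e52 := Nat.mul_le_mul_left (rankSet M 5).ncard f2
  have e60 := Nat.mul_le_mul_left (rankSet M 6).ncard f0
  have e61 := Nat.mul_le_mul_left (rankSet M 6).ncard f1
  have e62 := Nat.mul_le_mul_left (rankSet M 6).ncard f2
  have e70 := Nat.mul_le_mul_left (rankSet M 7).ncard f0
  have e71 := Nat.mul_le_mul_left (rankSet M 7).ncard f1
  linarith

/-- The arithmetic of the triangle consumer at `(9, 4)`: `u ≤ P₄ + 3 P₃`, `(14/5) P₄ ≤ f₅ + f₆`,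
`(28/5) P₃ ≤ f₄ + f₅ + f₆`, `y ≥ 4 f₃ + 7 f₄ + 8 f₅ + 8 f₆ + 4 f₇` give `(42/5) u ≤ y`. -/
theorem consumer_arith_nine_four_triangle {u y P4 P3 f3 f4 f5 f6 f7 : ℚ} (hU : u ≤ P4 + 3 * P3)
    (h74 : 14 / 5 * P4 ≤ f5 + f6) (h73 : 28 / 5 * P3 ≤ f4 + f5 + f6)
    (hY : 4 * f3 + 7 * f4 + 8 * f5 + 8 * f6 + 4 * f7 ≤ y) (hf3 : 0 ≤ f3) (hf4 : 0 ≤ f4) (hf5 : 0 ≤ f5)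
    (hf6 : 0 ≤ f6) (hf7 : 0 ≤ f7) : 42 / 5 * u ≤ y := by
  linarith

/-- **The triangle consumer at `(9, 4)`, conditional on the cell `(7, 4)` of `M`**: for `M` of rank `7` with
`RLS M 7 4` and `N` a `3`-circuit, `Φ(9, 4) · #U(M ⊕ N; 9, 4) ≤ #Y(M ⊕ N; 9, 4)`. -/
theorem c025_nine_four_disjointSum_triangle_of_rls (M N : Matroid α) [M.Finite] [N.Finite]
    (h : Disjoint M.E N.E) (hM : M.eRank = ((7 : ℕ) : ℕ∞)) (h74 : ThmN.RLS M 7 4) (hN : N.IsCircuit N.E)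
    (hN3 : N.E.ncard = 3) :
    phiK 9 4 * ({A : Set α | A ⊆ (M.disjointSum N h).E ∧ (M.disjointSum N h).eRk A = ((9 : ℕ) : ℕ∞) ∧
        (M.disjointSum N h).eRk ((M.disjointSum N h).E \ A) = ((4 : ℕ) : ℕ∞)}.ncard : ℚ) ≤
      ({A : Set α | A ⊆ (M.disjointSum N h).E ∧ ((4 : ℕ) : ℕ∞) < (M.disjointSum N h).eRk A ∧
        (M.disjointSum N h).eRk A < ((9 : ℕ) : ℕ∞)}.ncard : ℚ) := by
  have hU := ncard_U_disjointSum_circuit_le M N h (p := 9) (r := 7) (s := 2) rfl (by norm_num) hM hN hN3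
  have hY := ncard_Y_nine_four_triangle_ge M N h hN hN3
  have h74' : (14 / 5 : ℚ) * ((profileSet M 7 4).ncard : ℚ) ≤
      ((rankSet M 5).ncard : ℚ) + ((rankSet M 6).ncard : ℚ) := by
    have h0 := h74
    unfold ThmN.RLS at h0
    rw [phiK_seven_four, ySet_eq_rankSet_union_of_eq M (q := 4) (p := 7) (k := 5) (k' := 6) rfl rfl rfl,
      ncard_union_eq (rankSet_disjoint_of_ne M (by norm_num)) (rankSet_finite M 5) (rankSet_finite M 6)] at h0
    push_cast at h0
    exact h0
  have h73' : (28 / 5 : ℚ) * ((profileSet M 7 3).ncard : ℚ) ≤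
      ((rankSet M 4).ncard : ℚ) + ((rankSet M 5).ncard : ℚ) + ((rankSet M 6).ncard : ℚ) := by
    have h0 := SevenThree.c025_three_all M 7 (by norm_num)
    unfold ThmN.RLS at h0
    rw [phiK_seven_three,
      ySet_eq_rankSet_union3_of_eq M (q := 3) (p := 7) (k := 4) (k' := 5) (k'' := 6) rfl rfl rfl rfl,
      ncard_union_eq (Set.disjoint_union_left.mpr
        ⟨rankSet_disjoint_of_ne M (by norm_num), rankSet_disjoint_of_ne M (by norm_num)⟩)
        ((rankSet_finite M 4).union (rankSet_finite M 5)) (rankSet_finite M 6),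
      ncard_union_eq (rankSet_disjoint_of_ne M (by norm_num)) (rankSet_finite M 4) (rankSet_finite M 5)] at h0
    push_cast at h0
    exact h0
  rw [phiK_nine_four]
  have hU' : (({A : Set α | A ⊆ (M.disjointSum N h).E ∧ (M.disjointSum N h).eRk A = ((9 : ℕ) : ℕ∞) ∧
      (M.disjointSum N h).eRk ((M.disjointSum N h).E \ A) = ((4 : ℕ) : ℕ∞)}.ncard : ℕ) : ℚ) ≤
      ((profileSet M 7 4).ncard : ℚ) + 3 * ((profileSet M 7 3).ncard : ℚ) := by
    have hU2 : ({A : Set α | A ⊆ (M.disjointSum N h).E ∧ (M.disjointSum N h).eRk A = ((9 : ℕ) : ℕ∞) ∧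
        (M.disjointSum N h).eRk ((M.disjointSum N h).E \ A) = ((4 : ℕ) : ℕ∞)}.ncard : ℕ) ≤
        (profileSet M 7 4).ncard + 3 * (profileSet M 7 3).ncard := hU
    exact_mod_cast hU2
  have hY' : 4 * ((rankSet M 3).ncard : ℚ) + 7 * ((rankSet M 4).ncard : ℚ) + 8 * ((rankSet M 5).ncard : ℚ) +
      8 * ((rankSet M 6).ncard : ℚ) + 4 * ((rankSet M 7).ncard : ℚ) ≤
      (({A : Set α | A ⊆ (M.disjointSum N h).E ∧ ((4 : ℕ) : ℕ∞) < (M.disjointSum N h).eRk A ∧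
        (M.disjointSum N h).eRk A < ((9 : ℕ) : ℕ∞)}.ncard : ℕ) : ℚ) := by
    exact_mod_cast hY
  exact consumer_arith_nine_four_triangle hU' h74' h73' hY' (Nat.cast_nonneg _) (Nat.cast_nonneg _)
    (Nat.cast_nonneg _) (Nat.cast_nonneg _) (Nat.cast_nonneg _)

/-- **Every `(9, 5)` core with a triangle summand satisfies the `(9, 4)` body**: for `M` of rank `7` on `11`
points (the cell `(7, 4)` is Theorem M there) and `N` a `3`-circuit. -/
theorem c025_nine_four_disjointSum_triangle_of_ncard (M N : Matroid α) [M.Finite] [N.Finite]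
    (h : Disjoint M.E N.E) (hM : M.eRank = ((7 : ℕ) : ℕ∞)) (hE : M.E.ncard = 11) (hN : N.IsCircuit N.E)
    (hN3 : N.E.ncard = 3) :
    phiK 9 4 * ({A : Set α | A ⊆ (M.disjointSum N h).E ∧ (M.disjointSum N h).eRk A = ((9 : ℕ) : ℕ∞) ∧
        (M.disjointSum N h).eRk ((M.disjointSum N h).E \ A) = ((4 : ℕ) : ℕ∞)}.ncard : ℚ) ≤
      ({A : Set α | A ⊆ (M.disjointSum N h).E ∧ ((4 : ℕ) : ℕ∞) < (M.disjointSum N h).eRk A ∧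
        (M.disjointSum N h).eRk A < ((9 : ℕ) : ℕ∞)}.ncard : ℚ) :=
  c025_nine_four_disjointSum_triangle_of_rls M N h hM (ThmN.RLS_of_ncard_eq M (p := 7) (q := 4) hE) hN hN3

/-- **The triangle consumer at `(9, 4)` when every circuit of `M` has at least `6` elements** (the cell `(7, 4)`
is Theorem G′ there). -/
theorem c025_nine_four_disjointSum_triangle_of_circuits (M N : Matroid α) [M.Finite] [N.Finite]
    (h : Disjoint M.E N.E) (hM : M.eRank = ((7 : ℕ) : ℕ∞))
    (hcirc : ∀ C, M.IsCircuit C → ((6 : ℕ) : ℕ∞) ≤ C.encard) (hN : N.IsCircuit N.E) (hN3 : N.E.ncard = 3) :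
    phiK 9 4 * ({A : Set α | A ⊆ (M.disjointSum N h).E ∧ (M.disjointSum N h).eRk A = ((9 : ℕ) : ℕ∞) ∧
        (M.disjointSum N h).eRk ((M.disjointSum N h).E \ A) = ((4 : ℕ) : ℕ∞)}.ncard : ℚ) ≤
      ({A : Set α | A ⊆ (M.disjointSum N h).E ∧ ((4 : ℕ) : ℕ∞) < (M.disjointSum N h).eRk A ∧
        (M.disjointSum N h).eRk A < ((9 : ℕ) : ℕ∞)}.ncard : ℚ) :=
  c025_nine_four_disjointSum_triangle_of_rls M N h hM
    (ThmN.RLS_of_circuits M (p := 7) (q := 4) hcirc) hN hN3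

end S1

end PercRepro
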